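import Summits.KontsevichZagierPeriods.KontsevichZagierPeriods.Theorems.RootDecompWalshStrataEulerDescent07

/-!
# Conic descent, gen 6 (L4 one-variable Euler descent `[T, R(x)·√(ex²+fx+g)^{±1}] ∈ InBaker`), part 8/12

Declarations `pf_step` … `prod_split_count` of the farm-checked gen-6 monolith; see the module docstring of
`EulerDescent01` (part 1) for the overview, the design and the sources. [KontsevichZagier2001 §1.1–1.2; BCR1998 §2.2; Euler 1768; this node gen 4 `sqrtDescent_*`]
-/

noncomputable section

open Literature.NumberTheory.Transcendental
open MeasureTheory Set
open MvPolynomial (aeval)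
open Literature.ModelTheory.ExponentialFields (IsSemialgebraic isSemialgebraic_univ
  isSemialgebraic_setOf_eval_pos isSemialgebraic_setOf_eval_lt isSemialgebraic_setOf_eval_le
  isSemialgebraic_setOf_eval_nonneg isSemialgebraic_setOf_eval_eq_zero continuous_aeval_real
  tarski_seidenberg_real_holds)

namespace Summit.KontsevichZagierPeriods.RootDecompWalshStrata.ConicDescent

/-- The half-line `{t > 0}` is `ℚ`-semialgebraic (part-local `private` copy). [BCR1998 §2.2] -/
private theorem isSemialgebraic_pos' : IsSemialgebraic ℚ {v : Fin 1 → ℝ | 0 < v 0} := by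
  convert isSemialgebraic_setOf_eval_pos (k := ℚ) (R := ℝ)
    (MvPolynomial.X (0 : Fin 1) : MvPolynomial (Fin 1) ℚ) using 1
  ext v
  simp

/-- The half-line `{t > a}` is `ℚ`-semialgebraic (part-local `private` copy). [BCR1998 §2.2] -/
private theorem isSemialgebraic_gt' (a : ℚ) : IsSemialgebraic ℚ {v : Fin 1 → ℝ | (a : ℝ) < v 0} := by
  convert isSemialgebraic_setOf_eval_pos (k := ℚ) (R := ℝ)
    (MvPolynomial.X (0 : Fin 1) - MvPolynomial.C a : MvPolynomial (Fin 1) ℚ) using 1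
  ext v
  simp [sub_pos]

/-- One partial-fraction step: `N/((x − a)·M) = c/(x − a) + Ñ/M` with `c = N(a)/M(a)`,
`Ñ = (N − c·M)/(X − a)`; stated as the polynomial identity `(x − a)·Ñ(x) = N(x) − c·M(x)`. -/
theorem pf_step (N M : Polynomial ℚ) (a : ℚ) (hM : M.eval a ≠ 0) :
    ∃ (c : ℚ) (Nt : Polynomial ℚ), ∀ x : ℝ,
      (x - a) * Polynomial.aeval x Nt = Polynomial.aeval x N - c * Polynomial.aeval x M := by
  refine ⟨N.eval a / M.eval a,
    (N - Polynomial.C (N.eval a / M.eval a) * M) /ₘ (Polynomial.X - Polynomial.C a), fun x => ?_⟩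
  have hroot : Polynomial.IsRoot (N - Polynomial.C (N.eval a / M.eval a) * M) a := by
    rw [Polynomial.IsRoot, Polynomial.eval_sub, Polynomial.eval_mul, Polynomial.eval_C,
      div_mul_cancel₀ _ hM, sub_self]
  have hid := Polynomial.mul_divByMonic_eq_iff_isRoot.2 hroot
  have h := congrArg (Polynomial.aeval x) hid
  simp only [map_mul, map_sub, Polynomial.aeval_X, Polynomial.aeval_C, eq_ratCast] at h
  linear_combination h

/-- **BOOKKEEPING OVER DISTINCT SIMPLE RATIONAL POLES.** On a bounded `T ⊆ [lo, hi]`: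
`[T, N(x)/(Q₀(x)·∏_{a ∈ poles}(x − a))·√D] ∈ InBaker` whenever `Q₀` is hull-clean (no zero of
`Q₀` at `x` or at the mirror point `2x₀ − x` for `x ∈ [lo, hi]` — the hypothesis of `euler_factor`),
the `poles` are distinct rationals with `Q₀(a) ≠ 0`, and every pole `a` that is NOT a root of `D`
keeps a fixed distance `δ > 0` from `T` (a genuine representation forces this after finitely many
splits: a non-root pole in the closure of `T` makes `R·√D` non-integrable). Proof: induction on the
poles; one partial-fraction step `N/((x − a)M) = c/(x − a) + Ñ/M`; the atom `c·√D/(x − a)` is made a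
representation of its own by §24.10 (`= c·D/((x − a)√D)`, numerator bounded by `δ`, resp.
`= c·(e(x + a) + f)/√D` at a root) and settled by `simple_pole` / `root_pole_atom`; the rest is the
difference representation. [this node] -/
theorem InBaker.rat_factor (e f g : ℚ) (he : e ≠ 0) (hh : g - f ^ 2 / (4 * e) ≠ 0)
    (Q₀ : Polynomial ℚ) (lo hi δ : ℚ) (hδ : 0 < δ)
    (hQ₀ : ∀ x : ℝ, (lo : ℝ) ≤ x → x ≤ hi →
      Polynomial.aeval x Q₀ ≠ 0 ∧ Polynomial.aeval (2 * (((-f / (2 * e) : ℚ) : ℝ)) - x) Q₀ ≠ 0)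
    (poles : List ℚ) (hnd : poles.Nodup) (hQa : ∀ a ∈ poles, Q₀.eval a ≠ 0)
    (N : Polynomial ℚ) (r : KZ.IntegralRep 1)
    (hdom : ∀ v ∈ r.domain, (lo : ℝ) ≤ v 0 ∧ v 0 ≤ hi)
    (hsep : ∀ v ∈ r.domain, ∀ a ∈ poles, e * a ^ 2 + f * a + g ≠ 0 → (δ : ℝ) ≤ |v 0 - a|)
    (hr : EqOn r.integrand (fun v => Polynomial.aeval (v 0) N /
        (Polynomial.aeval (v 0) Q₀ * (poles.map fun a : ℚ => v 0 - (a : ℝ)).prod) *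
          √(qD e f g (v 0))) r.domain) :
    InBaker (KZ.of r) := by
  have hΔ := disc_ne_zero he hh
  induction poles generalizing N r with
  | nil =>
    refine InBaker.euler_factor e f g he hh N Q₀ lo hi r hdom hQ₀ fun v hv => ?_
    rw [hr hv]
    simp only [List.map_nil, List.prod_nil, mul_one]
  | cons a rest ih =>
    refine InBaker.restrict_pos e f g r _ hr fun r₁ hsub hpos hr₁ => ?_
    have hTsub : ∀ v ∈ r₁.domain, (lo : ℝ) ≤ v 0 ∧ v 0 ≤ hi ∧ 0 < qD e f g (v 0) :=
      fun v hv => ⟨(hdom v (hsub hv)).1, (hdom v (hsub hv)).2, hpos v hv⟩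
    -- no pole lies on the (positive part of the) domain
    have hoff : ∀ v ∈ r₁.domain, ∀ b ∈ a :: rest, v 0 ≠ (b : ℝ) := by
      intro v hv b hb hvb
      by_cases hDb : e * b ^ 2 + f * b + g = 0
      · have hD := hpos v hv
        rw [hvb, qD] at hD
        have : (e : ℝ) * b ^ 2 + f * b + g = 0 := by exact_mod_cast hDb
        exact hD.ne' this
      · have h := hsep v (hsub hv) b hb hDb
        rw [hvb, sub_self, abs_zero] at h
        exact not_lt.2 h (by exact_mod_cast hδ)
    -- the partial-fraction step at `a`, with `M = Q₀ · ∏_{rest} (X − b)`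
    have hnda : a ∉ rest := (List.nodup_cons.1 hnd).1
    have hndr : rest.Nodup := (List.nodup_cons.1 hnd).2
    obtain ⟨c, Nt, hid⟩ := pf_step N (Q₀ * (rest.map fun b => Polynomial.X - Polynomial.C b).prod) a
      (by rw [Polynomial.eval_mul]; exact mul_ne_zero (hQa a (by simp)) (eval_prodX_ne_zero rest a hnda))
    -- the atom `c·√D/(x − a)` as a representation of its own
    have hSA : IsSemialgebraic ℚ r₁.domain := r₁.isSemialgebraic_domain
    obtain ⟨rA, hdomA, hintA⟩ : ∃ rA : KZ.IntegralRep 1, rA.domain = r₁.domain ∧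
        rA.integrand = fun v => (c : ℝ) / (v 0 - a) * √(qD e f g (v 0)) := by
      by_cases hDa : e * a ^ 2 + f * a + g = 0
      · -- at a root: c√D/(x − a) = c(e(x + a) + f)/√D
        have hcont : Continuous fun x : ℝ => (c : ℝ) * ((e : ℝ) * (x + a) + f) := by fun_prop
        obtain ⟨M, hM⟩ := (isCompact_Icc : IsCompact (Icc (lo : ℝ) hi)).exists_bound_of_continuousOn
          hcont.continuousOn
        have hF : IsSemialgebraicFunOn ℚ r₁.domain fun v => (c : ℝ) * ((e : ℝ) * (v 0 + a) + f) :=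
          ((IsRatOn.const c).mul (((IsRatOn.const e).mul (IsRatOn.coord.add (IsRatOn.const a))).add
            (IsRatOn.const f))).isSemialgebraicFunOn hSA
        refine ⟨sqrtDivRep e f g hΔ lo hi r₁.domain hSA hTsub
          (fun v => (c : ℝ) / (v 0 - a) * √(qD e f g (v 0))) _ hF M
          (fun v hv => by
            rw [← Real.norm_eq_abs]; exact hM (v 0) ⟨(hTsub v hv).1, (hTsub v hv).2.1⟩)
          (fun v hv => ?_), rfl, rfl⟩
        have hD := hpos v hv
        have hs : √(qD e f g (v 0)) ≠ 0 := (Real.sqrt_pos.2 hD).ne'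
        have hxa : v 0 - (a : ℝ) ≠ 0 := sub_ne_zero.2 (hoff v hv a (by simp))
        have hfac : qD e f g (v 0) = (v 0 - a) * ((e : ℝ) * (v 0 + a) + f) := by
          have : (e : ℝ) * a ^ 2 + f * a + g = 0 := by exact_mod_cast hDa
          simp only [qD]; linear_combination this
        rw [eq_div_iff hs, mul_assoc, Real.mul_self_sqrt hD.le, hfac]
        field_simp
      · -- off the roots: c√D/(x − a) = (c·D/(x − a))/√D, numerator bounded thanks to `δ`
        have hcontD : Continuous fun x : ℝ => qD e f g x := by unfold qD; fun_prop
        obtain ⟨MD, hMD⟩ := (isCompact_Icc : IsCompact (Icc (lo : ℝ) hi)).exists_bound_of_continuousOn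
          hcontD.continuousOn
        have hF : IsSemialgebraicFunOn ℚ r₁.domain fun v => (c : ℝ) * qD e f g (v 0) / (v 0 - a) :=
          (((IsRatOn.const c).mul (IsRatOn.quad e f g)).div (IsRatOn.coord.sub (IsRatOn.const a))
            fun v hv => sub_ne_zero.2 (hoff v hv a (by simp))).isSemialgebraicFunOn hSA
        refine ⟨sqrtDivRep e f g hΔ lo hi r₁.domain hSA hTsub
          (fun v => (c : ℝ) / (v 0 - a) * √(qD e f g (v 0))) _ hF (|(c : ℝ)| * |MD| / δ)
          (fun v hv => ?_) (fun v hv => ?_), rfl, rfl⟩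
        · have hxa : (δ : ℝ) ≤ |v 0 - a| := hsep v (hsub hv) a (by simp) hDa
          have hδ' : (0 : ℝ) < δ := by exact_mod_cast hδ
          have hD : |qD e f g (v 0)| ≤ |MD| :=
            ((Real.norm_eq_abs _).symm.le.trans (hMD (v 0) ⟨(hTsub v hv).1, (hTsub v hv).2.1⟩)).trans
              (le_abs_self MD)
          rw [abs_div, abs_mul]
          calc |(c : ℝ)| * |qD e f g (v 0)| / |v 0 - ↑a|
              ≤ |(c : ℝ)| * |MD| / |v 0 - ↑a| :=
                div_le_div_of_nonneg_right (mul_le_mul_of_nonneg_left hD (abs_nonneg _)) (abs_nonneg _)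
            _ ≤ |(c : ℝ)| * |MD| / δ :=
                div_le_div_of_nonneg_left (mul_nonneg (abs_nonneg _) (abs_nonneg _)) hδ' hxa
        · have hD := hpos v hv
          have hs : √(qD e f g (v 0)) ≠ 0 := (Real.sqrt_pos.2 hD).ne'
          have hxa : v 0 - (a : ℝ) ≠ 0 := sub_ne_zero.2 (hoff v hv a (by simp))
          rw [eq_div_iff hs, mul_assoc, Real.mul_self_sqrt hD.le]
          field_simp
    -- the atom is in the Baker sector
    have hA : InBaker (KZ.of rA) := by
      by_cases hDa : e * a ^ 2 + f * a + g = 0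
      · exact InBaker.root_pole_atom e f g a c he hh hDa rA fun v _ => by rw [hintA]
      · exact InBaker.simple_pole e f g a c he hh hDa lo hi rA
          (fun v hv => ⟨(hTsub v (hdomA ▸ hv)).1, (hTsub v (hdomA ▸ hv)).2.1⟩)
          fun v _ => by rw [hintA]
    -- the rest is the difference representation, settled by induction
    refine InBaker.of_sub' r₁ rA hdomA hA (ih hndr (fun b hb => hQa b (List.mem_cons_of_mem a hb)) Nt
      (subRep r₁ rA hdomA) (fun v hv => hdom v (hsub hv))
      (fun v hv b hb hDb => hsep v (hsub hv) b (List.mem_cons_of_mem a hb) hDb) fun v hv => ?_)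
    have hv' : v ∈ r₁.domain := hv
    have hxa : v 0 - (a : ℝ) ≠ 0 := sub_ne_zero.2 (hoff v hv' a (by simp))
    have hQ : Polynomial.aeval (v 0) Q₀ ≠ 0 := (hQ₀ (v 0) (hTsub v hv').1 (hTsub v hv').2.1).1
    have hPr : (rest.map fun b : ℚ => v 0 - (b : ℝ)).prod ≠ 0 :=
      list_prod_sub_ne_zero rest (v 0) fun b hb => hoff v hv' b (List.mem_cons_of_mem a hb)
    have hidv := hid (v 0)
    rw [map_mul, aeval_prodX] at hidv
    have hN : Polynomial.aeval (v 0) N = (v 0 - a) * Polynomial.aeval (v 0) Nt +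
        c * (Polynomial.aeval (v 0) Q₀ * (rest.map fun b : ℚ => v 0 - (b : ℝ)).prod) := by
      linear_combination -hidv
    rw [subRep_integrand, hintA, hr₁ hv']
    simp only [List.map_cons, List.prod_cons]
    rw [hN]
    field_simp
    ring

/-! #### 24.13 Higher-order rational poles by inversion -/

/-- **Higher-order pole, right of it.** `[T, c·√D/(x − a)^k] ∈ InBaker` for `k ≥ 2`, `e ≠ 0`,
`h ≠ 0`, on a domain inside `{a + δ ≤ x ≤ a + H, D > 0}` (`δ > 0`): the inversion `x = a + 1/z`
turns it into `c·z^(k−3)·√D̃(z)` on `z ∈ (0, 1/δ]` with `D̃(z) = D(a)z² + D′(a)z + e` — for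
`D(a) ≠ 0` a polynomial factor (`k ≥ 3`) resp. a simple pole at `z = 0` (`k = 2`) of a genuine
conic, for `D(a) = 0` a LINEAR radicand `D′(a)z + e` (`linear_factor`). [this node] -/
theorem InBaker.pole_pow_right (e f g a c : ℚ) (he : e ≠ 0) (hh : g - f ^ 2 / (4 * e) ≠ 0)
    (k : ℕ) (hk : 2 ≤ k) (δ H : ℚ) (hδ : 0 < δ) (r : KZ.IntegralRep 1)
    (hdom : ∀ v ∈ r.domain, (a : ℝ) + δ ≤ v 0 ∧ v 0 ≤ a + H ∧ 0 < qD e f g (v 0))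
    (hr : EqOn r.integrand (fun v => (c : ℝ) / (v 0 - a) ^ k * √(qD e f g (v 0))) r.domain) :
    InBaker (KZ.of r) := by
  obtain ⟨Da, hDadef⟩ : ∃ Da : ℚ, Da = e * a ^ 2 + f * a + g := ⟨_, rfl⟩
  obtain ⟨f₁, hf₁def⟩ : ∃ f₁ : ℚ, f₁ = 2 * e * a + f := ⟨_, rfl⟩
  have hDt : ∀ z : ℝ, z ≠ 0 → qD Da f₁ e z = z ^ 2 * qD e f g ((a : ℝ) + z⁻¹) := fun z hz => by
    rw [hDadef, hf₁def]; simp only [qD]; push_cast; field_simp; ring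
  have hT₀ : IsSemialgebraic ℚ
      {v : Fin 1 → ℝ | v ∈ {v : Fin 1 → ℝ | 0 < v 0} ∧ 0 < qD Da f₁ e (v 0)} :=
    IsSemialgebraicFunOn.isSemialgebraic_sep_pos
      (isSemialgebraicFunOn_qD Da f₁ e isSemialgebraic_pos')
  have hδ' : (0 : ℝ) < δ := by exact_mod_cast hδ
  refine InBaker.of_invert' a r hT₀ (fun v hv => (show (0 : ℝ) < v 0 from hv.1).ne')
    (fun x hx => ?_) (fun v => (c : ℝ) * v 0 ^ k / v 0 ^ 3 * √(qD Da f₁ e (v 0))) ?_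
    (fun v hv hvd => ?_) fun r₃ hd₃ hi₃ => ?_
  · -- the chart covers the domain
    obtain ⟨hxa, -, hxD⟩ := hdom x hx
    have hxa' : 0 < x 0 - a := by linarith
    refine ⟨by linarith, inv_pos.2 hxa', ?_⟩
    change 0 < qD Da f₁ e (x 0 - a)⁻¹
    rw [hDt _ (inv_ne_zero hxa'.ne'), inv_inv, show (a : ℝ) + (x 0 - a) = x 0 by ring]
    exact mul_pos (pow_pos (inv_pos.2 hxa') 2) hxD
  · -- semialgebraic pull-back
    have h1 : IsRatOn {v : Fin 1 → ℝ | v ∈ {v : Fin 1 → ℝ | 0 < v 0} ∧ 0 < qD Da f₁ e (v 0)}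
        fun v => (c : ℝ) * v 0 ^ k / v 0 ^ 3 :=
      ((IsRatOn.const c).mul (IsRatOn.coord.pow k)).div (IsRatOn.coord.pow 3) fun v hv =>
        pow_ne_zero 3 (show (0 : ℝ) < v 0 from hv.1).ne'
    exact ((h1.isSemialgebraicFunOn hT₀).mul_holds (IsSemialgebraicFunOn.sqrt_holds
      (isSemialgebraicFunOn_qD Da f₁ e hT₀))).congr fun v _ => by simp only [Pi.mul_apply]
  · -- the pull-back `c/((1/z)^k)·√D(a + 1/z)/z² = c·z^k/z³·√D̃(z)` for `z > 0`
    have hz : (0 : ℝ) < v 0 := hv.1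
    rw [hr hvd]
    beta_reduce
    have hDx : qD e f g ((a : ℝ) + (v 0)⁻¹) = qD Da f₁ e (v 0) / v 0 ^ 2 := by
      rw [hDt _ hz.ne', mul_div_cancel_left₀ _ (pow_ne_zero 2 hz.ne')]
    rw [show (a : ℝ) + (v 0)⁻¹ - a = (v 0)⁻¹ by ring, hDx, Real.sqrt_div' _ (sq_nonneg _),
      Real.sqrt_sq hz.le, inv_pow]
    have hz0 : v 0 ≠ 0 := hz.ne'
    field_simp
  · -- the pulled-back representation lives on `z ∈ (0, 1/δ]`
    have hpos₃ : ∀ v ∈ r₃.domain, (0 : ℝ) < v 0 := fun v hv => by rw [hd₃] at hv; exact hv.1.1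
    have hdom₃ : ∀ v ∈ r₃.domain, ((0 : ℚ) : ℝ) ≤ v 0 ∧ v 0 ≤ ((1 / δ : ℚ) : ℝ) := by
      intro v hv
      have hz := hpos₃ v hv
      rw [hd₃] at hv
      obtain ⟨hxa, -, -⟩ := hdom _ hv.2
      have h1 : (δ : ℝ) ≤ (v 0)⁻¹ := by linarith
      refine ⟨by push_cast; exact hz.le, ?_⟩
      push_cast
      rw [one_div]
      exact (le_inv_comm₀ hz hδ').2 h1
    by_cases hDa : e * a ^ 2 + f * a + g = 0
    · -- `D(a) = 0`: linear radicand `D′(a)·z + e`, `D′(a) ≠ 0` since `Δ ≠ 0`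
      have hf₁ : f₁ ≠ 0 := by
        intro h0
        apply hh
        have h4 : g - f ^ 2 / (4 * e) = (e * a ^ 2 + f * a + g) - (2 * e * a + f) ^ 2 / (4 * e) := by
          field_simp; ring
        rw [h4, hDa, ← hf₁def, h0]; simp
      have hDa0 : Da = 0 := by rw [hDadef]; exact hDa
      subst hDa0
      exact InBaker.linear_factor f₁ e hf₁ (Polynomial.C c * Polynomial.X ^ k) (Polynomial.X ^ 3)
        r₃ (fun v hv => by simpa using pow_ne_zero 3 (hpos₃ v hv).ne') fun v _ => by
          rw [hi₃]; simp only [map_mul, map_pow, Polynomial.aeval_C, Polynomial.aeval_X, eq_ratCast]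
    · have hDa0 : Da ≠ 0 := by rw [hDadef]; exact hDa
      have hh₁ : e - f₁ ^ 2 / (4 * Da) ≠ 0 := by
        have h4 : e - f₁ ^ 2 / (4 * Da) = (4 * e * Da - f₁ ^ 2) / (4 * Da) := by field_simp
        have h5 : 4 * e * Da - f₁ ^ 2 = 4 * e * (g - f ^ 2 / (4 * e)) := by
          rw [hDadef, hf₁def]; field_simp; ring
        rw [h4, h5]
        exact div_ne_zero (mul_ne_zero (mul_ne_zero four_ne_zero he) hh)
          (mul_ne_zero four_ne_zero hDa0)
      rcases (show k = 2 ∨ 3 ≤ k by omega) with rfl | hk3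
      · -- `k = 2`: a simple pole of the new conic at `z = 0`, off the closure of the domain
        refine InBaker.simple_pole Da f₁ e 0 c hDa0 hh₁ (by simpa using he) 0 (1 / δ) r₃ hdom₃
          fun v hv => ?_
        have hz := (hpos₃ v hv).ne'
        rw [hi₃]
        beta_reduce
        rw [show (c : ℝ) * v 0 ^ 2 / v 0 ^ 3 = c / v 0 by
          rw [div_eq_div_iff (pow_ne_zero 3 hz) hz]; ring, Rat.cast_zero, sub_zero]
      · -- `k ≥ 3`: a polynomial factor
        refine InBaker.poly_factor Da f₁ e hDa0 hh₁ (Polynomial.C c * Polynomial.X ^ (k - 3)) 0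
          (1 / δ) r₃ hdom₃ fun v hv => ?_
        have hz := (hpos₃ v hv).ne'
        rw [hi₃]
        beta_reduce
        rw [map_mul, map_pow, Polynomial.aeval_C, Polynomial.aeval_X, eq_ratCast,
          show (c : ℝ) * v 0 ^ k / v 0 ^ 3 = c * v 0 ^ (k - 3) by
            rw [div_eq_iff (pow_ne_zero 3 hz), mul_assoc, ← pow_add, Nat.sub_add_cancel hk3]]

/-- **HIGHER-ORDER RATIONAL POLES** `[T, c·√D/(x − a)^k]`, `k ≥ 2`, on a bounded domain keeping
the distance `δ > 0` from `a` (forced for a genuine representation: `|x − a|^(−k)·√D` is not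
integrable at `a`, not even at a root): split at `a`, `pole_pow_right` on the right, and the
REFLECTION `x = 2a − t` (`D ↦ D₂`, `c ↦ (−1)^k·c`) followed by `pole_pow_right` on the left.
With §24.11–24.12: every `R ∈ ℚ(x)` whose denominator SPLITS over `ℚ` is settled. [this node] -/
theorem InBaker.pole_pow (e f g a c : ℚ) (he : e ≠ 0) (hh : g - f ^ 2 / (4 * e) ≠ 0)
    (k : ℕ) (hk : 2 ≤ k) (lo hi δ : ℚ) (hδ : 0 < δ) (r : KZ.IntegralRep 1)
    (hdom : ∀ v ∈ r.domain, (lo : ℝ) ≤ v 0 ∧ v 0 ≤ hi)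
    (hsep : ∀ v ∈ r.domain, (δ : ℝ) ≤ |v 0 - a|)
    (hr : EqOn r.integrand (fun v => (c : ℝ) / (v 0 - a) ^ k * √(qD e f g (v 0))) r.domain) :
    InBaker (KZ.of r) := by
  refine InBaker.restrict_pos e f g r _ hr fun r₁ hsub hpos hr₁ => ?_
  refine InBaker.of_split_at a r₁ (fun r₂ hd₂ hi₂ => ?_) fun r₂ hd₂ hi₂ => ?_
  · -- right of the pole
    refine InBaker.pole_pow_right e f g a c he hh k hk δ (hi - a) hδ r₂ (fun v hv => ?_)
      fun v hv => ?_
    · rw [hd₂] at hv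
      obtain ⟨hv₁, hva⟩ := hv
      have hs := hsep v (hsub hv₁)
      rw [abs_of_pos (sub_pos.2 hva)] at hs
      refine ⟨by linarith, ?_, hpos v hv₁⟩
      push_cast; linarith [(hdom v (hsub hv₁)).2]
    · rw [hd₂] at hv; rw [hi₂]; exact hr₁ hv.1
  · -- left of the pole: reflect `x = 2a − t`
    obtain ⟨f', hf'def⟩ : ∃ f' : ℚ, f' = -(4 * e * a + f) := ⟨_, rfl⟩
    obtain ⟨g', hg'def⟩ : ∃ g' : ℚ, g' = 4 * e * a ^ 2 + 2 * f * a + g := ⟨_, rfl⟩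
    obtain ⟨s, hsdef⟩ : ∃ s : ℚ, s = (-1) ^ k := ⟨_, rfl⟩
    have hs2 : (s : ℝ) * s = 1 := by
      rw [hsdef]; push_cast; rw [← pow_add, ← two_mul, pow_mul]; norm_num
    have hh' : g' - f' ^ 2 / (4 * e) ≠ 0 := by
      have h4 : g' - f' ^ 2 / (4 * e) = g - f ^ 2 / (4 * e) := by
        rw [hf'def, hg'def]; field_simp; ring
      rw [h4]; exact hh
    have hrefl : ∀ x : ℝ, qD e f g (2 * (a : ℝ) - x) = qD e f' g' x := fun x => by
      rw [hf'def, hg'def]; simp only [qD]; push_cast; ring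
    have hc2 : (((2 * a : ℚ)) : ℝ) = 2 * (a : ℝ) := by push_cast; ring
    have hT₀ : IsSemialgebraic ℚ
        {v : Fin 1 → ℝ | v ∈ {v : Fin 1 → ℝ | (a : ℝ) < v 0} ∧ 0 < qD e f' g' (v 0)} :=
      IsSemialgebraicFunOn.isSemialgebraic_sep_pos
        (isSemialgebraicFunOn_qD e f' g' (isSemialgebraic_gt' a))
    refine InBaker.of_reflect' (2 * a) r₂ hT₀ (fun x hx => ?_)
      (fun v => ((c * s : ℚ) : ℝ) / (v 0 - a) ^ k * √(qD e f' g' (v 0))) ?_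
      (fun v hv hvd => ?_) fun r₃ hd₃ hi₃ => ?_
    · -- the mirror image of the left piece lies right of `a` inside `{D₂ > 0}`
      rw [hd₂] at hx
      obtain ⟨hx₁, hxlt⟩ := hx
      refine ⟨?_, ?_⟩
      · change (a : ℝ) < (((2 * a : ℚ)) : ℝ) - x 0
        rw [hc2]; linarith
      · change 0 < qD e f' g' ((((2 * a : ℚ)) : ℝ) - x 0)
        rw [hc2, ← hrefl, sub_sub_cancel]
        exact hpos x hx₁
    · -- semialgebraic integrand on the mirror domain
      have h1 : IsRatOn
          {v : Fin 1 → ℝ | v ∈ {v : Fin 1 → ℝ | (a : ℝ) < v 0} ∧ 0 < qD e f' g' (v 0)}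
          fun v => ((c * s : ℚ) : ℝ) / (v 0 - a) ^ k :=
        (IsRatOn.const (c * s)).div ((IsRatOn.coord.sub (IsRatOn.const a)).pow k) fun v hv =>
          pow_ne_zero k (sub_ne_zero.2 (show (a : ℝ) < v 0 from hv.1).ne')
      exact ((h1.isSemialgebraicFunOn hT₀).mul_holds (IsSemialgebraicFunOn.sqrt_holds
        (isSemialgebraicFunOn_qD e f' g' hT₀))).congr fun v _ => by simp only [Pi.mul_apply]
    · -- the reflected integrand: `c/(a − t)^k = c·(−1)^k/(t − a)^k`
      have hvd' : (fun _ : Fin 1 => (((2 * a : ℚ)) : ℝ) - v 0) ∈ r₁.domain := by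
        rw [hd₂] at hvd; exact hvd.1
      have hta : v 0 - (a : ℝ) ≠ 0 := sub_ne_zero.2 (show (a : ℝ) < v 0 from hv.1).ne'
      rw [hi₂, hr₁ hvd']
      beta_reduce
      rw [hc2, hrefl, show 2 * (a : ℝ) - v 0 - a = -(v 0 - a) by ring, neg_pow, hsdef]
      push_cast
      have h1 : ((-1 : ℝ) ^ k) * (-1) ^ k = 1 := by rw [← pow_add, ← two_mul, pow_mul]; norm_num
      have hne : ((-1 : ℝ) ^ k) ≠ 0 := pow_ne_zero k (by norm_num)
      rw [div_mul_eq_mul_div, div_mul_eq_mul_div,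
        div_eq_div_iff (pow_ne_zero k hta) (mul_ne_zero hne (pow_ne_zero k hta))]
      linear_combination (c : ℝ) * √(qD e f' g' (v 0)) * (v 0 - a) ^ k * h1
    · -- the reflected piece is a right-of-the-pole power for `D₂` with constant `(−1)^k·c`
      refine InBaker.pole_pow_right e f' g' a (c * s) he hh' k hk δ (a - lo) hδ r₃ (fun v hv => ?_)
        fun v hv => ?_
      · rw [hd₃] at hv
        obtain ⟨⟨hva, hvD⟩, hvd⟩ := hv
        have hva : (a : ℝ) < v 0 := hva
        rw [hd₂] at hvd
        obtain ⟨hvd₁, -⟩ := hvd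
        have hsv := hsep _ (hsub hvd₁)
        have hlo := (hdom _ (hsub hvd₁)).1
        simp only [hc2] at hsv hlo
        rw [show 2 * (a : ℝ) - v 0 - a = -(v 0 - a) by ring, abs_neg, abs_of_pos (sub_pos.2 hva)] at hsv
        refine ⟨by linarith, ?_, hvD⟩
        push_cast; linarith
      · rw [hi₃]

/-! #### 24.14 Bookkeeping with multiplicities: every `R` whose denominator splits over `ℚ` -/

/-- `∏_{b ∈ l}(x − b) = (x − a)^(#a in l) · ∏_{b ∈ l, b ≠ a}(x − b)`. -/
theorem prod_split_count (l : List ℚ) (a : ℚ) (x : ℝ) :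
    (l.map fun b : ℚ => x - (b : ℝ)).prod =
      (x - a) ^ (l.count a) * ((l.filter fun b => b ≠ a).map fun b : ℚ => x - (b : ℝ)).prod := by
  induction l with
  | nil => simp
  | cons b rest ih =>
    by_cases hb : b = a
    · subst hb
      rw [List.count_cons_self, List.map_cons, List.prod_cons, ih, pow_succ,
        List.filter_cons_of_neg (by simp)]
      ring
    · rw [List.count_cons_of_ne hb, List.filter_cons_of_pos (by simpa using hb),
        List.map_cons, List.prod_cons, List.map_cons, List.prod_cons, ih]
      ring

end Summit.KontsevichZagierPeriods.RootDecompWalshStrata.ConicDescent
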